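import Mathlib
import HarnessLib
import Summits.NavierStokesRegularity.NavierStokesRegularity.Theorems.StableStrataDoorOneSliceAxiSeq
import Summits.NavierStokesRegularity.NavierStokesRegularity.Theorems.StableStrataDoorAlongTimes

/-!
# StableStrataDoorSeqDoorsHold — SEED-26 «the SEQUENTIAL ε-doors» UNCONDITIONAL (door S26 «StableStrataDoor»;
# nsreg-p1 g21 ADDENDUM-25A; consumer `StableStrataDoorOneSliceAxiSeq` (ns-door-S23-p1 g3) fed with I1 (v5)
# `StableStrataDoorAlongTimes.localPointZoomAlongTimesM_holds` (nsreg-p6 g14))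

* `targetSeqAxisymAt_holds (hν : 0 < ν) M A : TargetSeqAxisymAt ν M A` — DOOR T-axi-seq «no Type-I blow-up whose
  scale-normalised velocity comes within `ε(ν, M, A, U)` (`L¹(U)` equivariance defect) of axisymmetry about the axis
  `x₀ + ℝ·A e₃` ALONG SOME SEQUENCE of times `tₙ → T⁻`», for EVERY viscosity, Type-I constant and axis;
* `targetEpsAxisymAt_holds'` — hence S26's eventual door T-axi again (same `ε`), through the sequential one;
* `seqDoorAt_quiet_holds (hν : 0 < ν) M (hU : IsOpen U) (hne : U.Nonempty) : SeqDoorAt (quietPhi U) ν M` — DOOR T-quiet-seq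
  «no Type-I blow-up whose similarity window `U` is `ε`-quiet along SOME sequence of times».

All three inputs of the consumer are tree theorems: I1 `localPointZoomAlongTimesM_holds` (p6 g14), I2a `floorSurvives_holds`
(p6 g14), I2b `oneSliceAxiPropagation_holds` (p6 g14), (H1)/(H2)/(H3) from S26 (door lane).  Door family of LADDER-NS N0
(`--supports stmt-NavierStokesRegularity-0056`, helper lane).  WHAT THIS IS NOT: not NS regularity (Clay A) — ε-criteria INSIDE
the Type-I class (ε from compactness, not explicit); no route born, no item closed.
-/

noncomputable section

set_option linter.dupNamespace false

namespace Summit.NavierStokesRegularity.NavierStokesRegularity.Theorems.StableStrataDoorSeqDoorsHold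

open MeasureTheory Set Function Filter Topology TopologicalSpace Metric
open Literature.Analysis Literature.Analysis.FluidPDE
open Summit.NavierStokesRegularity.NavierStokesRegularity.Theorems.StableStrataDoorDefs
open Summit.NavierStokesRegularity.NavierStokesRegularity.Theorems.StableStrataDoorInstances
open Summit.NavierStokesRegularity.NavierStokesRegularity.Theorems.StableStrataDoorOneSliceSeqDoor
open Summit.NavierStokesRegularity.NavierStokesRegularity.Theorems.StableStrataDoorOneSliceAxiSeq
open Summit.NavierStokesRegularity.NavierStokesRegularity.Theorems.StableStrataDoorAlongTimes

/-- **DOOR T-axi-seq, UNCONDITIONAL**: `TargetSeqAxisymAt ν M A` for every `ν > 0`, every `M` and every axis isometry `A`. -/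
theorem targetSeqAxisymAt_holds {ν : ℝ} (hν : 0 < ν) (M : ℝ)
    (A : EuclideanSpace ℝ (Fin 3) ≃ₗᵢ[ℝ] EuclideanSpace ℝ (Fin 3)) : TargetSeqAxisymAt ν M A :=
  targetSeqAxisymAt_of_zoom hν A localPointZoomAlongTimesM_holds

/-- **S26's eventual door T-axi through the sequential one** (`TargetEpsAxisymAt ν M A`, same `ε`). -/
theorem targetEpsAxisymAt_holds' {ν : ℝ} (hν : 0 < ν) (M : ℝ)
    (A : EuclideanSpace ℝ (Fin 3) ≃ₗᵢ[ℝ] EuclideanSpace ℝ (Fin 3)) : TargetEpsAxisymAt ν M A :=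
  targetEpsAxisymAt_of_seq (targetSeqAxisymAt_holds hν M A)

/-- **DOOR T-quiet-seq, UNCONDITIONAL**: `SeqDoorAt (quietPhi U) ν M` for every `ν > 0`, every `M` and every open nonempty
window `U` — no Type-I blow-up whose similarity window is `ε`-quiet along some sequence of times. -/
theorem seqDoorAt_quiet_holds {ν : ℝ} (hν : 0 < ν) (M : ℝ) {U : Set (EuclideanSpace ℝ (Fin 3))}
    (hU : IsOpen U) (hne : U.Nonempty) : SeqDoorAt (quietPhi U) ν M :=
  seqDoorAt_quiet localPointZoomAlongTimesM_holds hν hU hne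

end Summit.NavierStokesRegularity.NavierStokesRegularity.Theorems.StableStrataDoorSeqDoorsHold
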